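import Literature.Probability.LatticeModels.MixingBoxConcentration
import Literature.Probability.LatticeModels.RandomCurrentsMixingEndgame
import Literature.Probability.LatticeModels.MixingBoxAAAG
import Literature.Probability.LatticeModels.TwoPointWindowLowerBound
import Literature.Probability.LatticeModels.CriticalTwoPointBounds
import Literature.Probability.LatticeModels.SharpnessSubcritical
import Literature.Probability.LatticeModels.MeanFieldBound
import Literature.Probability.LatticeModels.FarPointGoodDirections
import HarnessLib

/-!
# The switch weights `δ(𝐮,𝐱,𝐲)` in a finite volume and their insensitivity to regular far sources (Aizenman–Duminil-Copin 2021, §6.2)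

Topic `Literature/Probability/LatticeModels`. Definitions with bodies and theorems; **no named fact is
introduced** (D-0026).

M. Aizenman, H. Duminil-Copin, Ann. of Math. **194** (2021) = arXiv:1912.07973, §6.2, p. 25–26: the switch
weights "`δ(𝐮,𝐱,𝐲) := ∏ᵢ a_{x_i,y_i}(u_i)/(|𝒦| A_{x_i,y_i}(2^{k_i}))`" and, in the derivation of (6.9), their
insensitivity to the far sources: "Since all the `y_i, y'_i` are in regular scales … `𝔸_{y_i}(2^{k_i}) =
𝔸_{y'_i}(2^{k_i})` … Furthermore, Property 2 of regular scales implies that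
`|δ(𝐮,𝐱,𝐲) - δ(𝐮,𝐱,𝐲')| ≤ C₈s(M/N)δ(𝐮,𝐱,𝐲)`" (footnote: both are close to
`δ'(𝐮,𝐱) := ∏ᵢ ⟨σ_{x_i}σ_{u_i}⟩/(|𝒦|∑_{v_i}⟨σ_{x_i}σ_{v_i}⟩)`).

On the induced graph of a finite `Λ ⊆ ℤ^d` with constant couplings `β ≥ 0` (finite-volume two-point function
`T = boxTwoPt Λ β`), for the coefficients `Current.mixCoeff` of `MixingBoxConcentration`:

* `Current.dcoef` — the one-source factor `δ_i(v) = T(u,v)T(v,y)/(|𝒦| ∑_{w ∈ u+I_k} T(u,w)T(w,y))` (`v ∈ u + I_k`),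
  and `Current.switchWeight_mixCoeff` — **`δ(𝐯) = δ₁(v₁)δ₂(v₂)`** for the tree's `Current.switchWeight`;
* `Current.dref` — the reference weights `δ'(v) = T(u,v)/(|𝒦|∑_{w ∈ u+I_k} T(u,w))`, `∑_v δ'(v) = 1`;
* `abs_weight_ratio_sub_le` — the elementary closeness of two normalised weightings with ratios in
  `[α⁻, α⁺]`; `Current.abs_dcoef_sub_dref_le` — **`|δ_i(v) - δ'(v)| ≤ (α⁺/α⁻ - 1) δ'(v)`** when
  `α⁻T(u,y) ≤ T(w,y) ≤ α⁺T(u,y)` on the blocks (which P2 at the regular scale of `y` and the comparison with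
  `S` provide); `abs_mul_sub_mul_le_of_rel` — the product version.

## References

* M. Aizenman, H. Duminil-Copin, Ann. of Math. 194 (2021), arXiv:1912.07973, §6.2, definition of δ (p. 25) and
  the derivation of (6.9) with its footnote (p. 26) [AizenmanDuminilCopinAnnals2021].
-/

noncomputable section

open Finset Filter
open scoped symmDiff ENNReal

namespace Literature.Probability.LatticeModels

variable {d : ℕ}

/-! ### Elementary closeness of normalised weights -/

/-- **Two normalisations of the same positive weights with bounded distortion are close**: if `a > 0` and
`α⁻ ≤ ξ ≤ α⁺` on `s` (`0 < α⁻`), then for `v ∈ s`,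
`|a_v ξ_v/∑_w a_w ξ_w - a_v/∑_w a_w| ≤ (α⁺/α⁻ - 1) · a_v/∑_w a_w`. [folklore] -/
theorem abs_weight_ratio_sub_le {ι : Type*} (s : Finset ι) {a ξ : ι → ℝ} {αm αp : ℝ} (hαm : 0 < αm)
    (ha : ∀ w ∈ s, 0 < a w) (hξm : ∀ w ∈ s, αm ≤ ξ w) (hξp : ∀ w ∈ s, ξ w ≤ αp) {v : ι} (hv : v ∈ s) :
    |a v * ξ v / ∑ w ∈ s, a w * ξ w - a v / ∑ w ∈ s, a w| ≤ (αp / αm - 1) * (a v / ∑ w ∈ s, a w) := by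
  have hA : 0 < ∑ w ∈ s, a w := Finset.sum_pos ha ⟨v, hv⟩
  have hαp : αm ≤ αp := (hξm v hv).trans (hξp v hv)
  have hαp0 : 0 < αp := lt_of_lt_of_le hαm hαp
  have hB : 0 < ∑ w ∈ s, a w * ξ w :=
    Finset.sum_pos (fun w hw => mul_pos (ha w hw) (lt_of_lt_of_le hαm (hξm w hw))) ⟨v, hv⟩
  have hBlo : αm * ∑ w ∈ s, a w ≤ ∑ w ∈ s, a w * ξ w := by
    rw [Finset.mul_sum]
    exact Finset.sum_le_sum fun w hw => by
      rw [mul_comm]; exact mul_le_mul_of_nonneg_left (hξm w hw) (ha w hw).le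
  have hBhi : ∑ w ∈ s, a w * ξ w ≤ αp * ∑ w ∈ s, a w := by
    rw [Finset.mul_sum]
    exact Finset.sum_le_sum fun w hw => by
      rw [mul_comm αp]; exact mul_le_mul_of_nonneg_left (hξp w hw) (ha w hw).le
  have hav := ha v hv
  -- upper and lower bounds of the distorted ratio
  have hup : a v * ξ v / ∑ w ∈ s, a w * ξ w ≤ (αp / αm) * (a v / ∑ w ∈ s, a w) := by
    rw [div_le_iff₀ hB]
    calc a v * ξ v ≤ a v * αp := mul_le_mul_of_nonneg_left (hξp v hv) hav.le
      _ = (αp / αm) * (a v / ∑ w ∈ s, a w) * (αm * ∑ w ∈ s, a w) := by field_simp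
      _ ≤ (αp / αm) * (a v / ∑ w ∈ s, a w) * ∑ w ∈ s, a w * ξ w :=
          mul_le_mul_of_nonneg_left hBlo (by positivity)
  have hlo : (αm / αp) * (a v / ∑ w ∈ s, a w) ≤ a v * ξ v / ∑ w ∈ s, a w * ξ w := by
    rw [le_div_iff₀ hB]
    calc (αm / αp) * (a v / ∑ w ∈ s, a w) * ∑ w ∈ s, a w * ξ w
        ≤ (αm / αp) * (a v / ∑ w ∈ s, a w) * (αp * ∑ w ∈ s, a w) := mul_le_mul_of_nonneg_left hBhi (by positivity)
      _ = a v * αm := by field_simp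
      _ ≤ a v * ξ v := mul_le_mul_of_nonneg_left (hξm v hv) hav.le
  have hr0 : 0 ≤ a v / ∑ w ∈ s, a w := by positivity
  rw [abs_le]
  constructor
  · -- `-(αp/αm - 1) r ≤ (αm/αp) r - r ≤ x - r`
    have h1 : -((αp / αm - 1) * (a v / ∑ w ∈ s, a w)) ≤ (αm / αp - 1) * (a v / ∑ w ∈ s, a w) := by
      have : 1 - αm / αp ≤ αp / αm - 1 := by
        have hy : αm / αp = (αp / αm)⁻¹ := by rw [inv_div]
        rw [hy]
        have hz : 0 < αp / αm := by positivity
        have key : 2 ≤ αp / αm + (αp / αm)⁻¹ := by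
          have h : 0 ≤ (αp / αm - 1) ^ 2 / (αp / αm) := by positivity
          have e : (αp / αm - 1) ^ 2 / (αp / αm) = αp / αm - 2 + (αp / αm)⁻¹ := by field_simp; ring
          linarith
        linarith
      nlinarith
    nlinarith
  · nlinarith

/-- **Products of relatively close non-negative numbers**: `|dᵢ - rᵢ| ≤ μ rᵢ` (`rᵢ ≥ 0`, `dᵢ ≥ 0`, `μ ≥ 0`) gives
`|d₁d₂ - r₁r₂| ≤ ((1+μ)² - 1) r₁r₂`. [folklore] -/
theorem abs_mul_sub_mul_le_of_rel {d₁ d₂ r₁ r₂ μ : ℝ} (hμ : 0 ≤ μ) (hr₁ : 0 ≤ r₁) (hr₂ : 0 ≤ r₂) (hd₁ : 0 ≤ d₁) (hd₂ : 0 ≤ d₂)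
    (h₁ : |d₁ - r₁| ≤ μ * r₁) (h₂ : |d₂ - r₂| ≤ μ * r₂) :
    |d₁ * d₂ - r₁ * r₂| ≤ ((1 + μ) ^ 2 - 1) * (r₁ * r₂) := by
  rw [abs_le] at h₁ h₂ ⊢
  obtain ⟨h₁l, h₁u⟩ := h₁
  obtain ⟨h₂l, h₂u⟩ := h₂
  have hu₁ : d₁ ≤ (1 + μ) * r₁ := by linarith
  have hu₂ : d₂ ≤ (1 + μ) * r₂ := by linarith
  constructor
  · -- lower bound
    by_cases hμ1 : μ ≤ 1
    · have hl₁ : (1 - μ) * r₁ ≤ d₁ := by linarith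
      have hl₂ : (1 - μ) * r₂ ≤ d₂ := by linarith
      have h := mul_le_mul hl₁ hl₂ (mul_nonneg (by linarith) hr₂) hd₁
      nlinarith [mul_nonneg hr₁ hr₂]
    · push Not at hμ1
      nlinarith [mul_nonneg hd₁ hd₂, mul_nonneg hr₁ hr₂]
  · have h := mul_le_mul hu₁ hu₂ hd₂ (mul_nonneg (by linarith) hr₁)
    nlinarith

namespace Current

variable {Λ : Finset (Site d)} {β : ℝ}

/-! ### The switch weights of `mixCoeff` as real numbers -/

/-- The one-source factor of the switch weights: `δ_i(v) = T(u,v)T(v,y)/(|𝒦| ∑_{w ∈ u+I_k} T(u,w)T(w,y))` for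
`v ∈ u + I_k` (summed over `k ∈ 𝒦`; the blocks are disjoint in use). [cite: AizenmanDuminilCopinAnnals2021, arXiv:1912.07973 §6.2, δ(u,x,y) (p. 25)] -/
def dcoef (β : ℝ) (u y : ↥Λ) (𝒦 : Finset ℕ) (I : ℕ → Finset (Site d)) (v : ↥Λ) : ℝ :=
  ∑ k ∈ 𝒦, if ((v : Site d) - u) ∈ I k then
    boxTwoPt Λ β u v * boxTwoPt Λ β v y / (#𝒦 * ∑ w ∈ blk u I k, boxTwoPt Λ β u w * boxTwoPt Λ β w y) else 0

/-- The reference weights `δ'(v) = T(u,v)/(|𝒦| ∑_{w ∈ u+I_k} T(u,w))` (independent of the far source).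
[cite: AizenmanDuminilCopinAnnals2021, arXiv:1912.07973 §6.2, footnote on δ'(u,x) (p. 26)] -/
def dref (β : ℝ) (u : ↥Λ) (𝒦 : Finset ℕ) (I : ℕ → Finset (Site d)) (v : ↥Λ) : ℝ :=
  ∑ k ∈ 𝒦, if ((v : Site d) - u) ∈ I k then boxTwoPt Λ β u v / (#𝒦 * ∑ w ∈ blk u I k, boxTwoPt Λ β u w) else 0

variable (u : ↥Λ) (𝒦 : Finset ℕ) (I : ℕ → Finset (Site d))

/-- `T ≥ 0`. [folklore] -/
theorem boxTwoPt_nonneg (hβ : 0 ≤ β) (a b : ↥Λ) : 0 ≤ boxTwoPt Λ β a b := by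
  rw [boxTwoPt_eq_div hβ]; exact div_nonneg ENNReal.toReal_nonneg ENNReal.toReal_nonneg

/-- `δ' ≥ 0`. [folklore] -/
theorem dref_nonneg (hβ : 0 ≤ β) (v : ↥Λ) : 0 ≤ dref β u 𝒦 I v := by
  unfold dref
  refine Finset.sum_nonneg fun k _ => ?_
  split_ifs
  · exact div_nonneg (boxTwoPt_nonneg hβ u v) (mul_nonneg (Nat.cast_nonneg _)
      (Finset.sum_nonneg fun w _ => boxTwoPt_nonneg hβ u w))
  · exact le_rfl

/-- `δ_i ≥ 0`. [folklore] -/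
theorem dcoef_nonneg (hβ : 0 ≤ β) (y v : ↥Λ) : 0 ≤ dcoef β u y 𝒦 I v := by
  unfold dcoef
  refine Finset.sum_nonneg fun k _ => ?_
  split_ifs
  · exact div_nonneg (mul_nonneg (boxTwoPt_nonneg hβ u v) (boxTwoPt_nonneg hβ v y)) (mul_nonneg (Nat.cast_nonneg _)
      (Finset.sum_nonneg fun w _ => mul_nonneg (boxTwoPt_nonneg hβ u w) (boxTwoPt_nonneg hβ w y)))
  · exact le_rfl

/-- **`∑_v δ'(v) = 1`** (non-empty `𝒦`, blocks with positive sums). [folklore] -/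
theorem sum_dref_eq_one (h𝒦 : 𝒦.Nonempty) (hpos : ∀ k ∈ 𝒦, 0 < ∑ w ∈ blk u I k, boxTwoPt Λ β u w) :
    ∑ v, dref β u 𝒦 I v = 1 := by
  classical
  unfold dref
  rw [Finset.sum_comm]
  have hblock : ∀ k ∈ 𝒦, ∑ v : ↥Λ, (if ((v : Site d) - u) ∈ I k then
      boxTwoPt Λ β u v / (#𝒦 * ∑ w ∈ blk u I k, boxTwoPt Λ β u w) else 0) = (#𝒦 : ℝ)⁻¹ := by
    intro k hk
    rw [← Finset.sum_filter]
    change ∑ v ∈ blk u I k, boxTwoPt Λ β u v / (#𝒦 * ∑ w ∈ blk u I k, boxTwoPt Λ β u w) = _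
    rw [← Finset.sum_div, mul_comm, ← div_div, div_self (hpos k hk).ne', one_div]
  rw [Finset.sum_congr rfl hblock, Finset.sum_const, nsmul_eq_mul, mul_inv_cancel₀]
  exact_mod_cast (card_pos.2 h𝒦).ne'

/-- **`|δ_i(v) - δ'(v)| ≤ (α⁺/α⁻ - 1) δ'(v)`** when `α⁻ T(u,y) ≤ T(w,y) ≤ α⁺ T(u,y)` on the blocks (`0 < α⁻`),
`T(u,y) > 0`, `T(u,·) > 0` on the blocks. [cite: AizenmanDuminilCopinAnnals2021, arXiv:1912.07973 §6.2, "|δ(u,x,y) − δ(u,x,y')| ≤ C₈s(M/N)δ(u,x,y)" and footnote (p. 26)] -/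
theorem abs_dcoef_sub_dref_le (y : ↥Λ) {αm αp : ℝ} (hαm : 0 < αm) (hTuy : 0 < boxTwoPt Λ β u y)
    (hTpos : ∀ k ∈ 𝒦, ∀ w ∈ blk u I k, 0 < boxTwoPt Λ β u w)
    (hlo : ∀ k ∈ 𝒦, ∀ w ∈ blk u I k, αm * boxTwoPt Λ β u y ≤ boxTwoPt Λ β w y)
    (hhi : ∀ k ∈ 𝒦, ∀ w ∈ blk u I k, boxTwoPt Λ β w y ≤ αp * boxTwoPt Λ β u y) (v : ↥Λ) :
    |dcoef β u y 𝒦 I v - dref β u 𝒦 I v| ≤ (αp / αm - 1) * dref β u 𝒦 I v := by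
  classical
  unfold dcoef dref
  rw [← Finset.sum_sub_distrib, Finset.mul_sum]
  refine (Finset.abs_sum_le_sum_abs _ _).trans (Finset.sum_le_sum fun k hk => ?_)
  split_ifs with hv
  · have hvblk : v ∈ blk u I k := by unfold blk; simpa using hv
    -- the distortion `ξ_w = T(w,y)/T(u,y)`
    obtain ⟨ξ, hξ⟩ : ∃ ξ : ↥Λ → ℝ, ξ = fun w => boxTwoPt Λ β w y / boxTwoPt Λ β u y := ⟨_, rfl⟩
    have hξw : ∀ w, ξ w = boxTwoPt Λ β w y / boxTwoPt Λ β u y := fun w => by rw [hξ]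
    have hξm : ∀ w ∈ blk u I k, αm ≤ ξ w := fun w hw => by
      rw [hξw, le_div_iff₀ hTuy]; exact hlo k hk w hw
    have hξp : ∀ w ∈ blk u I k, ξ w ≤ αp := fun w hw => by
      rw [hξw, div_le_iff₀ hTuy]; exact hhi k hk w hw
    have h := abs_weight_ratio_sub_le (blk u I k) (a := fun w => boxTwoPt Λ β u w) hαm (hTpos k hk) hξm hξp hvblk
    -- rewrite both sides with `T(w,y) = ξ_w T(u,y)`
    have hTwy : ∀ w : ↥Λ, boxTwoPt Λ β w y = ξ w * boxTwoPt Λ β u y := fun w => by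
      rw [hξw, div_mul_cancel₀ _ hTuy.ne']
    have h𝒦0 : (0 : ℝ) < #𝒦 := by exact_mod_cast card_pos.2 ⟨k, hk⟩
    have hA : 0 < ∑ w ∈ blk u I k, boxTwoPt Λ β u w := Finset.sum_pos (hTpos k hk) ⟨v, hvblk⟩
    have hB : 0 < ∑ w ∈ blk u I k, boxTwoPt Λ β u w * ξ w :=
      Finset.sum_pos (fun w hw => mul_pos (hTpos k hk w hw) (lt_of_lt_of_le hαm (hξm w hw))) ⟨v, hvblk⟩
    have e1 : boxTwoPt Λ β u v * boxTwoPt Λ β v y / (#𝒦 * ∑ w ∈ blk u I k, boxTwoPt Λ β u w * boxTwoPt Λ β w y) =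
        (#𝒦 : ℝ)⁻¹ * (boxTwoPt Λ β u v * ξ v / ∑ w ∈ blk u I k, boxTwoPt Λ β u w * ξ w) := by
      have : ∑ w ∈ blk u I k, boxTwoPt Λ β u w * boxTwoPt Λ β w y = (∑ w ∈ blk u I k, boxTwoPt Λ β u w * ξ w) * boxTwoPt Λ β u y := by
        rw [Finset.sum_mul]; exact Finset.sum_congr rfl fun w _ => by rw [hTwy w]; ring
      rw [this, hTwy v, show boxTwoPt Λ β u v * (ξ v * boxTwoPt Λ β u y) = (boxTwoPt Λ β u v * ξ v) * boxTwoPt Λ β u y by ring,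
        show (#𝒦 : ℝ) * ((∑ w ∈ blk u I k, boxTwoPt Λ β u w * ξ w) * boxTwoPt Λ β u y) =
          ((#𝒦 : ℝ) * ∑ w ∈ blk u I k, boxTwoPt Λ β u w * ξ w) * boxTwoPt Λ β u y by ring,
        mul_div_mul_right _ _ hTuy.ne', mul_comm (#𝒦 : ℝ) _, ← div_div, div_eq_mul_inv _ (#𝒦 : ℝ), mul_comm]
    have e2 : boxTwoPt Λ β u v / (#𝒦 * ∑ w ∈ blk u I k, boxTwoPt Λ β u w) =
        (#𝒦 : ℝ)⁻¹ * (boxTwoPt Λ β u v / ∑ w ∈ blk u I k, boxTwoPt Λ β u w) := by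
      rw [mul_comm (#𝒦 : ℝ) _, ← div_div, div_eq_mul_inv _ (#𝒦 : ℝ), mul_comm]
    rw [e1, e2, ← mul_sub, abs_mul, abs_of_pos (inv_pos.2 h𝒦0)]
    calc (#𝒦 : ℝ)⁻¹ * |boxTwoPt Λ β u v * ξ v / ∑ w ∈ blk u I k, boxTwoPt Λ β u w * ξ w -
          boxTwoPt Λ β u v / ∑ w ∈ blk u I k, boxTwoPt Λ β u w|
        ≤ (#𝒦 : ℝ)⁻¹ * ((αp / αm - 1) * (boxTwoPt Λ β u v / ∑ w ∈ blk u I k, boxTwoPt Λ β u w)) :=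
          mul_le_mul_of_nonneg_left h (inv_pos.2 h𝒦0).le
      _ = _ := by ring
  · simp

/-- **`δ = δ₁ δ₂` for the coefficients `mixCoeff`**: the tree's `Current.switchWeight` of the two `mixCoeff`
families, with centre sources `x₁ = x₂ = u`, is the product of the two `dcoef` factors (blocks with positive
sums, `T(u,yᵢ) > 0`, `β ≥ 0`). [cite: AizenmanDuminilCopinAnnals2021, arXiv:1912.07973 §6.2, δ(u,x,y) := ∏ᵢ a_{x_i,y_i}(u_i)/(|𝒦|A_{x_i,y_i}(2^{k_i})) (p. 25)] -/
theorem switchWeight_mixCoeff (hβ : 0 ≤ β) (y₁ y₂ : ↥Λ) (I₁ I₂ : ℕ → Finset (Site d))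
    (hpos₁ : ∀ k ∈ 𝒦, 0 < ∑ w ∈ blk u I₁ k, boxTwoPt Λ β u w * boxTwoPt Λ β w y₁)
    (hpos₂ : ∀ k ∈ 𝒦, 0 < ∑ w ∈ blk u I₂ k, boxTwoPt Λ β u w * boxTwoPt Λ β w y₂)
    (hTy₁ : 0 < boxTwoPt Λ β u y₁) (hTy₂ : 0 < boxTwoPt Λ β u y₂) (v₁ v₂ : ↥Λ) :
    switchWeight (Kc Λ β) u u y₁ y₂ (mixCoeff β u y₁ 𝒦 I₁) (mixCoeff β u y₂ 𝒦 I₂) v₁ v₂ =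
      dcoef β u y₁ 𝒦 I₁ v₁ * dcoef β u y₂ 𝒦 I₂ v₂ := by
  classical
  have hK : ∀ e, 0 ≤ Kc Λ β e := fun _ => hβ
  obtain ⟨z0, hz0⟩ : ∃ z0 : ℝ, z0 = (ecurrentSum (Kc Λ β) ∅).toReal := ⟨_, rfl⟩
  have hz0pos : 0 < z0 := by rw [hz0]; exact ENNReal.toReal_pos (ecurrentSum_empty_ne_zero _) (ecurrentSum_ne_top hK _)
  obtain ⟨T, hT⟩ : ∃ T : ↥Λ → ↥Λ → ℝ, T = boxTwoPt Λ β := ⟨_, rfl⟩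
  have hTnn : ∀ a b, 0 ≤ T a b := fun a b => by rw [hT]; exact boxTwoPt_nonneg hβ a b
  have hZ : ∀ a b : ↥Λ, ecurrentSum (Kc Λ β) ({a} ∆ {b}) = ENNReal.ofReal (T a b * z0) := fun a b => by
    rw [hT, hz0, ← toReal_ecurrentSum_pair hβ, ENNReal.ofReal_toReal (ecurrentSum_ne_top hK _)]
  have hZ0 : ecurrentSum (Kc Λ β) ∅ = ENNReal.ofReal z0 := by
    rw [hz0]; exact (ENNReal.ofReal_toReal (ecurrentSum_ne_top hK _)).symm
  -- the coefficients as `ofReal`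
  have hcoef : ∀ {y : ↥Λ} {I : ℕ → Finset (Site d)}, (∀ k ∈ 𝒦, 0 < ∑ w ∈ blk u I k, T u w * T w y) → ∀ v : ↥Λ,
      mixCoeff β u y 𝒦 I v = ENNReal.ofReal (∑ k ∈ 𝒦, if ((v : Site d) - u) ∈ I k then
        T u y / (#𝒦 * ∑ w ∈ blk u I k, T u w * T w y) else 0) := by
    intro y I hpos v
    rcases 𝒦.eq_empty_or_nonempty with h𝒦e | h𝒦ne
    · rw [h𝒦e]; unfold mixCoeff; simp
    have h𝒦pos : (0 : ℝ) < #𝒦 := by exact_mod_cast card_pos.2 h𝒦ne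
    have hbs : ∀ k, blkSum β u y I k = ENNReal.ofReal (z0 ^ 2 * ∑ w ∈ blk u I k, T u w * T w y) := by
      intro k
      unfold blkSum
      have hterm : ∀ w ∈ blk u I k, ecurrentSum (Kc Λ β) ({u} ∆ {w}) * ecurrentSum (Kc Λ β) ({w} ∆ {y}) =
          ENNReal.ofReal (z0 ^ 2 * (T u w * T w y)) := by
        intro w _
        rw [hZ, hZ, ← ENNReal.ofReal_mul (mul_nonneg (hTnn _ _) hz0pos.le)]
        congr 1; ring
      rw [Finset.sum_congr rfl hterm, ← ENNReal.ofReal_sum_of_nonneg (fun w _ => by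
        have := hTnn u w; have := hTnn w y; positivity), ← Finset.mul_sum]
    unfold mixCoeff
    rw [ENNReal.ofReal_sum_of_nonneg (fun k hk => by
      split_ifs
      · exact div_nonneg (hTnn u y) (mul_nonneg (Nat.cast_nonneg _) (hpos k hk).le)
      · exact le_rfl)]
    refine Finset.sum_congr rfl fun k hk => ?_
    split_ifs with hv
    · rw [hZ, hZ0, hbs, show (((#𝒦 : ℕ) : ℝ≥0∞)) = ENNReal.ofReal (#𝒦 : ℝ) by rw [ENNReal.ofReal_natCast],
        ← ENNReal.ofReal_inv_of_pos h𝒦pos, ← ENNReal.ofReal_inv_of_pos (mul_pos (pow_pos hz0pos 2) (hpos k hk)),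
        ← ENNReal.ofReal_mul (mul_nonneg (hTnn u y) hz0pos.le), ← ENNReal.ofReal_mul (inv_nonneg.2 h𝒦pos.le),
        ← ENNReal.ofReal_mul (mul_nonneg (mul_nonneg (hTnn u y) hz0pos.le) hz0pos.le)]
      congr 1
      rw [div_eq_mul_inv, mul_inv, mul_inv]
      have hzz : z0 * z0 * (z0 ^ 2)⁻¹ = 1 := by rw [← sq, mul_inv_cancel₀ (pow_ne_zero 2 hz0pos.ne')]
      calc T u y * z0 * z0 * ((#𝒦 : ℝ)⁻¹ * ((z0 ^ 2)⁻¹ * (∑ w ∈ blk u I k, T u w * T w y)⁻¹))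
          = T u y * ((#𝒦 : ℝ)⁻¹ * (∑ w ∈ blk u I k, T u w * T w y)⁻¹) * (z0 * z0 * (z0 ^ 2)⁻¹) := by ring
        _ = _ := by rw [hzz, mul_one]
    · rw [ENNReal.ofReal_zero]
  rw [← hT] at hpos₁ hpos₂ hTy₁ hTy₂
  set r₁ : ℝ := ∑ k ∈ 𝒦, (if ((v₁ : Site d) - u) ∈ I₁ k then T u y₁ / (#𝒦 * ∑ w ∈ blk u I₁ k, T u w * T w y₁) else 0) with hr₁
  set r₂ : ℝ := ∑ k ∈ 𝒦, (if ((v₂ : Site d) - u) ∈ I₂ k then T u y₂ / (#𝒦 * ∑ w ∈ blk u I₂ k, T u w * T w y₂) else 0) with hr₂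
  have hr₁0 : 0 ≤ r₁ := Finset.sum_nonneg fun k hk => by
    split_ifs; exacts [div_nonneg (hTnn _ _) (mul_nonneg (Nat.cast_nonneg _) (hpos₁ k hk).le), le_rfl]
  have hr₂0 : 0 ≤ r₂ := Finset.sum_nonneg fun k hk => by
    split_ifs; exacts [div_nonneg (hTnn _ _) (mul_nonneg (Nat.cast_nonneg _) (hpos₂ k hk).le), le_rfl]
  unfold switchWeight srcNrm
  rw [hcoef hpos₁ v₁, hcoef hpos₂ v₂, ← hr₁, ← hr₂]
  simp only [hZ, hZ0]
  -- numerator and denominator as single `ofReal`s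
  have hnum : ENNReal.ofReal r₁ * ENNReal.ofReal r₂ *
      (ENNReal.ofReal z0 * ENNReal.ofReal (T u v₁ * z0) * (ENNReal.ofReal z0 * ENNReal.ofReal (T u v₂ * z0)) *
        (ENNReal.ofReal z0 * ENNReal.ofReal (T v₁ y₁ * z0) * (ENNReal.ofReal z0 * ENNReal.ofReal (T v₂ y₂ * z0)))) =
      ENNReal.ofReal (r₁ * r₂ * (z0 ^ 8 * (T u v₁ * T u v₂ * (T v₁ y₁ * T v₂ y₂)))) := by
    have h1 : ∀ a b : ↥Λ, ENNReal.ofReal z0 * ENNReal.ofReal (T a b * z0) = ENNReal.ofReal (z0 ^ 2 * T a b) := by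
      intro a b; rw [← ENNReal.ofReal_mul hz0pos.le]; congr 1; ring
    simp only [h1]
    rw [← ENNReal.ofReal_mul hr₁0, ← ENNReal.ofReal_mul (by have := hTnn u v₁; positivity),
      ← ENNReal.ofReal_mul (by have := hTnn v₁ y₁; positivity),
      ← ENNReal.ofReal_mul (by have := hTnn u v₁; have := hTnn u v₂; positivity),
      ← ENNReal.ofReal_mul (mul_nonneg hr₁0 hr₂0)]
    congr 1; ring
  have hden : ENNReal.ofReal z0 * ENNReal.ofReal (T u y₁ * z0) * (ENNReal.ofReal z0 * ENNReal.ofReal (T u y₂ * z0)) *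
      ENNReal.ofReal z0 ^ 4 = ENNReal.ofReal (z0 ^ 8 * (T u y₁ * T u y₂)) := by
    rw [← ENNReal.ofReal_pow hz0pos.le, ← ENNReal.ofReal_mul hz0pos.le, ← ENNReal.ofReal_mul hz0pos.le,
      ← ENNReal.ofReal_mul (mul_nonneg hz0pos.le (mul_nonneg (hTnn u y₁) hz0pos.le)),
      ← ENNReal.ofReal_mul (mul_nonneg (mul_nonneg hz0pos.le (mul_nonneg (hTnn u y₁) hz0pos.le))
        (mul_nonneg hz0pos.le (mul_nonneg (hTnn u y₂) hz0pos.le)))]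
    congr 1; ring
  have hN0 : 0 ≤ r₁ * r₂ * (z0 ^ 8 * (T u v₁ * T u v₂ * (T v₁ y₁ * T v₂ y₂))) :=
    mul_nonneg (mul_nonneg hr₁0 hr₂0) (mul_nonneg (pow_nonneg hz0pos.le 8)
      (mul_nonneg (mul_nonneg (hTnn _ _) (hTnn _ _)) (mul_nonneg (hTnn _ _) (hTnn _ _))))
  have hD0 : 0 ≤ z0 ^ 8 * (T u y₁ * T u y₂) := mul_nonneg (pow_nonneg hz0pos.le 8) (mul_nonneg (hTnn _ _) (hTnn _ _))
  rw [hnum, hden, ENNReal.toReal_ofReal hN0, ENNReal.toReal_ofReal hD0]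
  -- the real identity
  have hd : ∀ {y : ↥Λ} {I : ℕ → Finset (Site d)} (v : ↥Λ), 0 < T u y →
      dcoef β u y 𝒦 I v = (∑ k ∈ 𝒦, (if ((v : Site d) - u) ∈ I k then T u y / (#𝒦 * ∑ w ∈ blk u I k, T u w * T w y) else 0)) *
        (T u v * T v y / T u y) := by
    intro y I v hTy
    unfold dcoef
    rw [← hT, Finset.sum_mul]
    refine Finset.sum_congr rfl fun k _ => ?_
    split_ifs
    · rw [div_mul_div_comm, mul_comm (T u y) _, mul_div_mul_right _ _ hTy.ne']
    · rw [zero_mul]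
  rw [hd v₁ hTy₁, hd v₂ hTy₂, ← hr₁, ← hr₂]
  have hz8 : z0 ^ 8 ≠ 0 := pow_ne_zero 8 hz0pos.ne'
  rw [mul_div_assoc', mul_div_assoc', div_mul_div_comm,
    show r₁ * r₂ * (z0 ^ 8 * (T u v₁ * T u v₂ * (T v₁ y₁ * T v₂ y₂))) = z0 ^ 8 * (r₁ * (T u v₁ * T v₁ y₁) * (r₂ * (T u v₂ * T v₂ y₂))) by ring,
    mul_div_mul_left _ _ hz8]

end Current

end Literature.Probability.LatticeModels

/-!
# (6.16) along the boxes `Λ_L ↑ ℤ⁴`: the two-point inputs and the eventual comparison (Aizenman–Duminil-Copin 2021, §6.2)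

Topic `Literature/Probability/LatticeModels`. Definitions with bodies and theorems; **no named fact is
introduced** (D-0026).

`MixingBoxAAAG.box_mixingCore_prob` is (6.16) of Aizenman–Duminil-Copin 2021 (arXiv:1912.07973, §6.2) on a
fixed finite volume `Λ ⊆ ℤ⁴`, with deterministic hypotheses of three kinds: (a) properties of the infinite-volume
two-point function `S_β` (positivity, the Infrared Bound, a lower bound on the switch blocks), (b) properties of
the index families of switch points (the hypotheses of (6.5) and of the sets `𝔸_y`), and (c) the comparison
`(1-η)S_β ≤ ⟨·⟩_Λ` on finitely many pairs together with `Λ` containing the points involved. This file supplies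
(a) for `0 < β ≤ β_c` in `d = 4` from the tree (`twoPointPlus_pos`, `twoPointFree_criticalBeta_upper_holds` and
monotonicity in `β`, `twoPointFree_ge_of_window`), (b) for the two kinds of far sources used in §6.1 — an
ARBITRARY far source (index sets `goodCube`, `FarPointGoodDirections`: domination with constant `1`) and a far
source in a REGULAR scale (Remark 6.5: `IsRegularScale.shift_le`) — and (c) eventually along `Λ = Λ_L`
(`BoxTwoPointTransfer.eventually_box_twoPoint_approx`), and packages the result as
`Current.box_mixingCore_prob_eventually`: for fixed data, (6.16) holds on `Λ_L` for all large `L`.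

## References

* M. Aizenman, H. Duminil-Copin, Ann. of Math. 194 (2021), arXiv:1912.07973, §6.2, (6.16), Remark 6.5
  (pp. 23–25) [AizenmanDuminilCopinAnnals2021].
-/

noncomputable section

open Finset Filter
open scoped symmDiff ENNReal

namespace Literature.Probability.LatticeModels

/-! ### (a) The two-point function of `ℤ⁴` for `0 < β ≤ β_c` -/

/-- **`S_β > 0` on `ℤ⁴` for `0 < β ≤ β_c`** (`S^free = S^+` there, and `⟨σ₀σ_x⟩⁺ > 0`). [folklore] -/
theorem twoPointFree_pos_four {β : ℝ} (hβ : 0 < β) (hβc : β ≤ criticalBeta 4) (x : Site 4) : 0 < twoPointFree 4 β x := by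
  rw [twoPointFree_eq_twoPointPlus_of_spontaneousMagnetization_eq_zero hβ.le
    (spontaneousMagnetization_eq_zero_of_le_criticalBeta_four hβ.le hβc) x]
  exact twoPointPlus_pos hβ x

/-- **The Infrared Bound for `β ≤ β_c` in `d = 4`, sup-norm form**: `S_β(x) ≤ C_IR/‖x‖_∞²` (`x ≠ 0`), with
`C_IR ≥ 0` (from `S_{β_c}(x) ≤ C‖x‖^{-(d-2)}` and the monotonicity of `S_β` in `β`).
[cite: AizenmanDuminilCopinAnnals2021, arXiv:1912.07973 (5.2) (the Infrared Bound, p. 17)] -/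
theorem twoPointFree_infraredBound_four :
    ∃ CIR : ℝ, 0 ≤ CIR ∧ ∀ β : ℝ, 0 ≤ β → β ≤ criticalBeta 4 → ∀ x : Site 4, x ≠ 0 →
      twoPointFree 4 β x ≤ CIR / (Site.supNorm x : ℝ) ^ 2 := by
  obtain ⟨C, hC⟩ := twoPointFree_criticalBeta_upper_holds (d := 4) (by norm_num)
  refine ⟨max C 0, le_max_right _ _, fun β hβ hβc x hx => ?_⟩
  have hmono := twoPointFree_mono_beta isingCorr_free_mono_beta_holds hasBoxLimit_isingCorr_free_holds hβ hβc x
  refine hmono.trans ((hC x hx).trans ?_)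
  have hn : (0 : ℝ) < Site.supNorm x := by
    have : Site.supNorm x ≠ 0 := fun h => hx (Site.supNorm_eq_zero_iff.1 h)
    exact_mod_cast Nat.pos_of_ne_zero this
  rw [Site.norm_eq_supNorm, show (-((4 : ℕ) - 2 : ℝ)) = -(2 : ℝ) by norm_num, Real.rpow_neg hn.le,
    show (2 : ℝ) = ((2 : ℕ) : ℝ) by norm_num, Real.rpow_natCast, ← div_eq_mul_inv]
  exact div_le_div_of_nonneg_right (le_max_left _ _) (by positivity)

/-- **A lower bound on `S_β` on a bounded set of scales in the window** (Cor. 5.8): for `0 < β ≤ β_c`, `2 ≤ N` in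
the window and `0 < ‖x‖_∞ ≤ M` with `16M ≤ N`, `S_β(x) ≥ s_W(M) := e⁻²/(32β_c)/(216(16M)³)`.
[cite: AizenmanDuminilCopinAnnals2021, arXiv:1912.07973 Corollary 5.8 (p. 19)] -/
theorem twoPointFree_ge_uniform_of_window {β : ℝ} (hβ : 0 < β) (hβc : β ≤ criticalBeta 4) {N M : ℕ} (hN : 2 ≤ N)
    (hwin : β = criticalBeta 4 ∨ (0 < β ∧ (N : ℝ) * invCorrLength (twoPointPlus 4 β) ≤ 1)) (hMN : 16 * M ≤ N)
    {x : Site 4} (hx : x ≠ 0) (hxM : Site.supNorm x ≤ M) :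
    Real.exp (-2) / (32 * criticalBeta 4) / (216 * (16 * (M : ℝ)) ^ 3) ≤ twoPointFree 4 β x := by
  have h := twoPointFree_ge_of_window hβ hβc hN hwin hx (by omega)
  refine le_trans ?_ h
  have hm1 : (1 : ℝ) ≤ Site.supNorm x := by
    have : Site.supNorm x ≠ 0 := fun h => hx (Site.supNorm_eq_zero_iff.1 h)
    exact_mod_cast Nat.one_le_iff_ne_zero.2 this
  have hβc0 : 0 < criticalBeta 4 := lt_of_lt_of_le hβ hβc
  have hxM' : (Site.supNorm x : ℝ) ≤ M := by exact_mod_cast hxM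
  gcongr

/-! ### (c) The eventual comparison along boxes -/

/-- **Comparability of `Λ_L` with `ℤ⁴` on a finite set of pairs at loss `η`**: every pair lies in `Λ_L` and
`(1-η) S_β(b-a) ≤ ⟨σ_aσ_b⟩^free_{Λ_L,β}`. [folklore] -/
def BoxComparable (β η : ℝ) (L : ℕ) (P : Finset (Site 4 × Site 4)) : Prop :=
  ∀ ab ∈ P, ∃ (ha : ab.1 ∈ box 4 L) (hb : ab.2 ∈ box 4 L),
    (1 - η) * twoPointFree 4 β (ab.2 - ab.1) ≤ boxTwoPt (box 4 L) β ⟨ab.1, ha⟩ ⟨ab.2, hb⟩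

/-- **Comparability holds for all large `L`** (`β ≥ 0`, `η > 0`; `BoxTwoPointTransfer`). [cite: FriedliVelenik2017, Exercise 3.16 and Thm 3.17 (p. 114)] -/
theorem eventually_boxComparable {β η : ℝ} (hβ : 0 ≤ β) (hη : 0 < η) (P : Finset (Site 4 × Site 4)) :
    ∀ᶠ L : ℕ in atTop, BoxComparable β η L P := by
  filter_upwards [eventually_box_twoPoint_approx hβ P hη] with L hL
  intro ab hab
  obtain ⟨ha, hb, hge, -⟩ := hL ab hab
  refine ⟨ha, hb, ?_⟩
  unfold boxTwoPt
  rw [← isingTwoPoint_free_eq_boxGraph (box 4 L) β ⟨ab.1, ha⟩ ⟨ab.2, hb⟩]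
  exact hge

/-- Comparability is monotone in the set of pairs. [folklore] -/
theorem BoxComparable.mono {β η : ℝ} {L : ℕ} {P Q : Finset (Site 4 × Site 4)} (h : BoxComparable β η L P) (hQP : Q ⊆ P) :
    BoxComparable β η L Q := fun ab hab => h ab (hQP hab)

/-- Extracting one pair. [folklore] -/
theorem BoxComparable.pair {β η : ℝ} {L : ℕ} {P : Finset (Site 4 × Site 4)} (h : BoxComparable β η L P) {a b : Site 4}
    (hab : (a, b) ∈ P) :
    ∃ (ha : a ∈ box 4 L) (hb : b ∈ box 4 L), (1 - η) * twoPointFree 4 β (b - a) ≤ boxTwoPt (box 4 L) β ⟨a, ha⟩ ⟨b, hb⟩ :=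
  h (a, b) hab

/-- The pairs compared for one far source `y`, centre `u`, index family `I` on the scales `𝒦`:
`(u,y)`, `(u,u+v)`, `(u+v,y)` (`v ∈ I_k`, `k ∈ 𝒦`). [folklore] -/
def mixPairs (u y : Site 4) (𝒦 : Finset ℕ) (I : ℕ → Finset (Site 4)) : Finset (Site 4 × Site 4) :=
  {(u, y)} ∪ (𝒦.biUnion fun k => (I k).image fun v => (u, u + v)) ∪ (𝒦.biUnion fun k => (I k).image fun v => (u + v, y))

/-- Membership of the three kinds of pairs. [folklore] -/
theorem mem_mixPairs (u y : Site 4) (𝒦 : Finset ℕ) (I : ℕ → Finset (Site 4)) :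
    (u, y) ∈ mixPairs u y 𝒦 I ∧ (∀ k ∈ 𝒦, ∀ v ∈ I k, (u, u + v) ∈ mixPairs u y 𝒦 I) ∧
      ∀ k ∈ 𝒦, ∀ v ∈ I k, (u + v, y) ∈ mixPairs u y 𝒦 I := by
  unfold mixPairs
  refine ⟨by simp, fun k hk v hv => ?_, fun k hk v hv => ?_⟩
  · refine mem_union_left _ (mem_union_right _ ?_)
    rw [mem_biUnion]; exact ⟨k, hk, mem_image.2 ⟨v, hv, rfl⟩⟩
  · refine mem_union_right _ ?_
    rw [mem_biUnion]; exact ⟨k, hk, mem_image.2 ⟨v, hv, rfl⟩⟩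

/-- **What comparability on `mixPairs` gives**, in the form of the hypotheses of `box_mixingCore_prob`: the points
lie in `Λ_L`, and the lower comparisons on `(u,y)` and on the blocks. [folklore] -/
theorem BoxComparable.mixPairs_spec {β η : ℝ} {L : ℕ} {u y : Site 4} {𝒦 : Finset ℕ} {I : ℕ → Finset (Site 4)}
    (h : BoxComparable β η L (mixPairs u y 𝒦 I)) :
    ∃ (hu : u ∈ box 4 L) (hy : y ∈ box 4 L),
      (∀ k ∈ 𝒦, ∀ v ∈ I k, u + v ∈ box 4 L) ∧
      (1 - η) * twoPointFree 4 β (y - u) ≤ boxTwoPt (box 4 L) β ⟨u, hu⟩ ⟨y, hy⟩ ∧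
      ∀ k ∈ 𝒦, ∀ v ∈ Current.blk (⟨u, hu⟩ : ↥(box 4 L)) I k,
        (1 - η) * twoPointFree 4 β ((v : Site 4) - u) ≤ boxTwoPt (box 4 L) β ⟨u, hu⟩ v ∧
          (1 - η) * twoPointFree 4 β (y - (v : Site 4)) ≤ boxTwoPt (box 4 L) β v ⟨y, hy⟩ := by
  obtain ⟨huy, huv, hvy⟩ := mem_mixPairs u y 𝒦 I
  obtain ⟨hu, hy, h1⟩ := h.pair huy
  refine ⟨hu, hy, fun k hk v hv => ?_, h1, fun k hk v hv => ?_⟩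
  · obtain ⟨-, hb, -⟩ := h.pair (huv k hk v hv); exact hb
  · have hvI : ((v : Site 4) - u) ∈ I k := by
      unfold Current.blk at hv; exact (mem_filter.1 hv).2
    have heq : u + ((v : Site 4) - u) = (v : Site 4) := by abel
    obtain ⟨ha', hb, h2⟩ := h.pair (huv k hk _ hvI)
    obtain ⟨ha, hb', h3⟩ := h.pair (hvy k hk _ hvI)
    have hbv : (⟨u + ((v : Site 4) - u), hb⟩ : ↥(box 4 L)) = v := Subtype.ext heq
    have hav : (⟨u + ((v : Site 4) - u), ha⟩ : ↥(box 4 L)) = v := Subtype.ext heq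
    rw [hbv] at h2; rw [hav] at h3
    refine ⟨?_, ?_⟩
    · rwa [show u + ((v : Site 4) - u) - u = (v : Site 4) - u by abel] at h2
    · rwa [heq] at h3

/-! ### (b) The two index families -/

/-- A dominant coordinate axis of `y` (`|y_{i₀}| = ‖y‖_∞`). [folklore] -/
def domAxis (y : Site 4) : Fin 4 :=
  Classical.choose (Site.exists_natAbs_eq_supNorm (d := 4) ⟨0, mem_univ _⟩ y)

/-- The defining property of `domAxis`. [folklore] -/
theorem natAbs_domAxis (y : Site 4) : (y (domAxis y)).natAbs = Site.supNorm y :=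
  Classical.choose_spec (Site.exists_natAbs_eq_supNorm (d := 4) ⟨0, mem_univ _⟩ y)

/-- **The index family for an ARBITRARY far source** `y'` (relative position): the cube of good switch points at
scale `2^k`, width `2^k/8` (`FarPointGoodDirections.goodCube`). [cite: AizenmanDuminilCopinAnnals2021, arXiv:1912.07973 §6.2, the sets 𝔸_y(2^k) and Remark 6.5 (p. 23)] -/
def arbFamily (y' : Site 4) (k : ℕ) : Finset (Site 4) := goodCube y' (domAxis y') (2 ^ k) (2 ^ k / 8)

/-- **The index family for a far source in a REGULAR scale**: a fixed cube in `Ann(2^k, 2^{k+1})`, the same for all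
such sources (Remark 6.5: "`𝔸_y(m)` is equal to `Ann(m,2m)`" — any fixed large subset does). [cite: AizenmanDuminilCopinAnnals2021, arXiv:1912.07973 §6.2, Remark 6.5 (p. 23)] -/
def regFamily (k : ℕ) : Finset (Site 4) := goodCube (0 : Site 4) ⟨0, by norm_num⟩ (2 ^ k) (2 ^ k / 2)

/-- `(⌊n/q⌋ + 1) ≥ n/q` in `ℝ` (`q > 0`). [folklore] -/
theorem div_le_natDiv_add_one (n : ℕ) {q : ℕ} (hq : 0 < q) : (n : ℝ) / q ≤ (n / q : ℕ) + 1 := by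
  rw [div_le_iff₀ (by exact_mod_cast hq)]
  have h := Nat.lt_div_mul_add hq (a := n)
  have : (n : ℝ) < ((n / q : ℕ) : ℝ) * q + q := by exact_mod_cast h
  nlinarith

/-- **Properties of `arbFamily`** (the hypotheses of (6.5) and of `𝔸_y` with `γ = 1/4096`, `κ = 0`, `θ = 1`): for
`β ≥ 0`, `4·2^k ≤ ‖y'‖_∞` and `r ≤ 2^k/8`. [cite: AizenmanDuminilCopinAnnals2021, arXiv:1912.07973 §6.2, Remark 6.5 (p. 23)] -/
theorem arbFamily_spec {β : ℝ} (hβ : 0 ≤ β) (y' : Site 4) {k r : ℕ} (hk : 4 * 2 ^ k ≤ Site.supNorm y') (hr : r ≤ 2 ^ k / 8)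
    (Y : ℝ) :
    arbFamily y' k ⊆ ann 4 (2 ^ k) (2 * 2 ^ k) ∧ (1 / 4096 : ℝ) * (2 ^ k : ℝ) ^ 4 ≤ #(arbFamily y' k) ∧
      (∀ u ∈ arbFamily y' k, twoPointFree 4 β y' ≤ (1 + 0 * 2 ^ k / Y) * twoPointFree 4 β (y' - u)) ∧
      (∀ u ∈ arbFamily y' k, ∀ p : Site 4, Site.supNorm p ≤ r → twoPointFree 4 β (y' - p) ≤ 1 * twoPointFree 4 β (y' - u)) := by
  have hw : 2 * 4 * (2 ^ k / 8) ≤ 2 ^ k := by omega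
  have hdom : ∀ u ∈ arbFamily y' k, ∀ p : Site 4, Site.supNorm p ≤ 2 ^ k / 8 →
      twoPointFree 4 β (y' - p) ≤ twoPointFree 4 β (y' - u) := fun u hu p hp =>
    twoPointFree_sub_le_of_mem_goodCube hβ (natAbs_domAxis y') hw hk hu (mem_box_iff_supNorm_le.2 hp)
  refine ⟨goodCube_subset_ann y' _ (by omega), ?_, fun u hu => ?_, fun u hu p hp => ?_⟩
  · unfold arbFamily
    rw [card_goodCube]
    push_cast
    have h := div_le_natDiv_add_one (2 ^ k) (q := 8) (by norm_num)
    push_cast at h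
    have h0 : (0 : ℝ) ≤ (2 : ℝ) ^ k / 8 := by positivity
    calc (1 / 4096 : ℝ) * (2 ^ k : ℝ) ^ 4 = ((2 : ℝ) ^ k / 8) ^ 4 := by ring
      _ ≤ (((2 ^ k / 8 : ℕ) : ℝ) + 1) ^ 4 := pow_le_pow_left₀ h0 h 4
  · rw [zero_mul, zero_div, add_zero, one_mul]
    have h := hdom u hu 0 (by rw [Site.supNorm_eq_zero_iff.2 rfl]; exact Nat.zero_le _)
    rwa [sub_zero] at h
  · rw [one_mul]; exact hdom u hu p (hp.trans hr)

/-- **Properties of `regFamily`** for a far source `y' ∈ Ann(2^{k_y}, 2^{k_y+1})` of a `(c,C)`-regular scale `k_y`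
(`C ≥ 0`, `S ≥ 0`), with `4·2^k ≤ 2^{k_y}` and `2r ≤ 2^{k_y}`: the hypotheses of (6.5) and of `𝔸_y` with
`γ = 1/16`, `κ = 8C`, any `Y ≤ ‖y'‖`, and `θ = 1 + 4C` (Remark 6.5 through `IsRegularScale.shift_le`).
[cite: AizenmanDuminilCopinAnnals2021, arXiv:1912.07973 §6.2, Remark 6.5 (p. 23); Def. 5.11, P2 (p. 20)] -/
theorem regFamily_spec {S : Site 4 → ℝ} (hS : ∀ x, 0 ≤ S x) {c C : ℝ} (hC : 0 ≤ C) {ky : ℕ} (hreg : IsRegularScale S c C (2 ^ ky))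
    {y' : Site 4} (hy : y' ∈ ann 4 (2 ^ ky) (2 * 2 ^ ky)) {k r : ℕ} (hk : 4 * 2 ^ k ≤ 2 ^ ky) (hr : 2 * r ≤ 2 ^ ky)
    {Y : ℝ} (hY0 : 0 < Y) (hYy : Y ≤ Site.supNorm y') :
    regFamily k ⊆ ann 4 (2 ^ k) (2 * 2 ^ k) ∧ (1 / 16 : ℝ) * (2 ^ k : ℝ) ^ 4 ≤ #(regFamily k) ∧
      (∀ u ∈ regFamily k, S y' ≤ (1 + 8 * C * 2 ^ k / Y) * S (y' - u)) ∧
      (∀ u ∈ regFamily k, ∀ p : Site 4, Site.supNorm p ≤ r → S (y' - p) ≤ (1 + 4 * C) * S (y' - u)) := by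
  have hsub : regFamily k ⊆ ann 4 (2 ^ k) (2 * 2 ^ k) := goodCube_subset_ann _ _ (by omega)
  have hypos : (0 : ℝ) < Site.supNorm y' := lt_of_lt_of_le hY0 hYy
  have hnorm_u : ∀ u ∈ regFamily k, Site.supNorm u ≤ 2 * 2 ^ k := fun u hu => (mem_ann.1 (hsub hu)).2
  refine ⟨hsub, ?_, fun u hu => ?_, fun u hu p hp => ?_⟩
  · unfold regFamily
    rw [card_goodCube]
    push_cast
    have h := div_le_natDiv_add_one (2 ^ k) (q := 2) (by norm_num)
    push_cast at h
    have h0 : (0 : ℝ) ≤ (2 : ℝ) ^ k / 2 := by positivity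
    calc (1 / 16 : ℝ) * (2 ^ k : ℝ) ^ 4 = ((2 : ℝ) ^ k / 2) ^ 4 := by ring
      _ ≤ (((2 ^ k / 2 : ℕ) : ℝ) + 1) ^ 4 := pow_le_pow_left₀ h0 h 4
  · have h0 : Site.supNorm (0 : Site 4) = 0 := Site.supNorm_eq_zero_iff.2 rfl
    have h := hreg.shift_le hC hS hy (w := 0) (w' := u) (by rw [h0]; omega) (by have := hnorm_u u hu; omega)
    rw [sub_zero, zero_sub, Site.supNorm_neg] at h
    refine h.trans (mul_le_mul_of_nonneg_right ?_ (hS _))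
    have h1 : (Site.supNorm u : ℝ) ≤ 2 * 2 ^ k := by exact_mod_cast hnorm_u u hu
    have h2 : 4 * C * ((Site.supNorm u : ℝ) / Site.supNorm y') ≤ 8 * C * 2 ^ k / Y := by
      rw [mul_div_assoc', div_le_div_iff₀ hypos hY0]
      calc 4 * C * (Site.supNorm u : ℝ) * Y ≤ 4 * C * (2 * 2 ^ k) * Site.supNorm y' :=
            mul_le_mul (mul_le_mul_of_nonneg_left h1 (by positivity)) hYy hY0.le (by positivity)
        _ = 8 * C * 2 ^ k * Site.supNorm y' := by ring
    linarith
  · have h := hreg.shift_le hC hS hy (w := p) (w' := u) (by omega) (by have := hnorm_u u hu; omega)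
    refine h.trans (mul_le_mul_of_nonneg_right ?_ (hS _))
    have hpu : Site.supNorm (p - u) ≤ Site.supNorm y' := by
      have h1 := Site.supNorm_add_le p (-u)
      rw [← sub_eq_add_neg, Site.supNorm_neg] at h1
      have := hnorm_u u hu
      have hy1 := (mem_ann.1 hy).1
      omega
    have : 4 * C * ((Site.supNorm (p - u) : ℝ) / Site.supNorm y') ≤ 4 * C := by
      have hle : (Site.supNorm (p - u) : ℝ) / Site.supNorm y' ≤ 1 := by
        rw [div_le_one hypos]; exact_mod_cast hpu
      nlinarith
    linarith

/-! ### (6.16) along the boxes -/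

namespace Current

open Classical in
/-- **(6.16) on `Λ_L` for all large `L`** (`t = 2`, `s = 4`, centre sources `x₁ = x₂ = u`). For `0 < β ≤ β_c`, a
centre `u`, far sources `y₁, y₂` (`‖yᵢ - u‖ > N₄`), scales `𝒦` and index families `I₁, I₂` with the deterministic
hypotheses of `box_mixingCore_prob` ((6.5) and `𝔸_y`: regular separated scales, `I k ⊆ Ann(2^k,2^{k+1})` of size
`≥ γ2^{4k}`, domination with `(κ, Y)` and with `θ`, `S ≥ s_W > 0` on the blocks), radii as there, and a loss
`0 < η < 1`: for all large `L`, for `[0,1]`-valued `Φ` local inside `Λ_{n₀}(u)` and `Ψ` local outside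
`Λ_{N₄+1}(u)`, `|P^{uy₁,uy₂}_{Λ_L}[ΦΨ] - ∑ δ P^{uv₁,uv₂}_{Λ_L}[Φ] P^{v₁y₁,v₂y₂}_{Λ_L}[Ψ]| ≤ √(q²-1) + E`.
[cite: AizenmanDuminilCopinAnnals2021, arXiv:1912.07973 §6.2, (6.16) (p. 25)] -/
theorem box_mixingCore_prob_eventually {β : ℝ} (hβ : 0 < β) (hβc : β ≤ criticalBeta 4) {CIR : ℝ} (hCIR : 0 ≤ CIR)
    (hIR : ∀ x : Site 4, x ≠ 0 → twoPointFree 4 β x ≤ CIR / (Site.supNorm x : ℝ) ^ 2)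
    (u y₁ y₂ : Site 4) (𝒦 : Finset ℕ) (I₁ I₂ : ℕ → Finset (Site 4))
    {c C κ Y γ η sW θ : ℝ} (hc : 0 < c) (hC : 0 ≤ C) (hκ : 0 ≤ κ) (hγ : 0 < γ) (hη0 : 0 < η) (hη1 : η < 1)
    (hsW : 0 < sW) (hθ : 0 ≤ θ)
    (h𝒦 : 𝒦.Nonempty) (hreg : ∀ j ∈ 𝒦, IsRegularScale (twoPointFree 4 β) c C (2 ^ j))
    (hsep : ∀ j ∈ 𝒦, ∀ j' ∈ 𝒦, j < j' → (C + 2) * 2 ^ j < (2 ^ j' : ℝ)) (hY : ∀ j ∈ 𝒦, (2 ^ j : ℝ) ≤ Y)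
    (hI₁ : ∀ j ∈ 𝒦, I₁ j ⊆ ann 4 (2 ^ j) (2 * 2 ^ j)) (hI₂ : ∀ j ∈ 𝒦, I₂ j ⊆ ann 4 (2 ^ j) (2 * 2 ^ j))
    (hcard₁ : ∀ j ∈ 𝒦, γ * (2 ^ j : ℝ) ^ 4 ≤ #(I₁ j)) (hcard₂ : ∀ j ∈ 𝒦, γ * (2 ^ j : ℝ) ^ 4 ≤ #(I₂ j))
    (hdom₁ : ∀ j ∈ 𝒦, ∀ v ∈ I₁ j, twoPointFree 4 β (y₁ - u) ≤ (1 + κ * 2 ^ j / Y) * twoPointFree 4 β (y₁ - u - v))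
    (hdom₂ : ∀ j ∈ 𝒦, ∀ v ∈ I₂ j, twoPointFree 4 β (y₂ - u) ≤ (1 + κ * 2 ^ j / Y) * twoPointFree 4 β (y₂ - u - v))
    {n₀ r mℓ m₀ M₃ R N₄ : ℕ} (hn₀ : 1 ≤ n₀) (hn₀r : n₀ < r) (hrmℓ : r < mℓ) (hrm : r ≤ m₀ + 1) (h12 : n₀ ≤ m₀)
    (h23 : m₀ ≤ M₃) (hMR : M₃ < R) (hRN : R ≤ N₄)
    (hmℓ𝒦 : ∀ j ∈ 𝒦, mℓ ≤ 2 ^ j) (hM𝒦 : ∀ j ∈ 𝒦, 2 * 2 ^ j ≤ M₃)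
    (hfar₁ : N₄ < Site.supNorm (y₁ - u)) (hfar₂ : N₄ < Site.supNorm (y₂ - u))
    (hdomθ₁ : ∀ j ∈ 𝒦, ∀ v ∈ I₁ j, ∀ p : Site 4, Site.supNorm p ≤ r →
      twoPointFree 4 β (y₁ - u - p) ≤ θ * twoPointFree 4 β (y₁ - u - v))
    (hdomθ₂ : ∀ j ∈ 𝒦, ∀ v ∈ I₂ j, ∀ p : Site 4, Site.supNorm p ≤ r →
      twoPointFree 4 β (y₂ - u - p) ≤ θ * twoPointFree 4 β (y₂ - u - v))
    (hsW₁ : ∀ j ∈ 𝒦, ∀ v ∈ I₁ j, sW ≤ twoPointFree 4 β v) (hsW₂ : ∀ j ∈ 𝒦, ∀ v ∈ I₂ j, sW ≤ twoPointFree 4 β v) :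
    ∀ᶠ L : ℕ in atTop, ∀ (hu : u ∈ box 4 L) (hy₁ : y₁ ∈ box 4 L) (hy₂ : y₂ ∈ box 4 L),
      ∀ Φ Ψ : FourCfg (boxGraph (box 4 L)) → ℝ≥0∞, (∀ pq, Φ pq ≤ 1) → (∀ pq, Ψ pq ≤ 1) →
        FourLocal (edgesWithin (G := boxGraph (box 4 L)) ⟨u, hu⟩ n₀) Φ →
        FourLocal (edgesBeyond (G := boxGraph (box 4 L)) ⟨u, hu⟩ (N₄ + 1)) Ψ →
        |srcProb (Kc (box 4 L) β) ({⟨u, hu⟩} ∆ {⟨y₁, hy₁⟩}) ({⟨u, hu⟩} ∆ {⟨y₂, hy₂⟩}) (Φ * Ψ) -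
          ∑ v₁, ∑ v₂, switchWeight (Kc (box 4 L) β) ⟨u, hu⟩ ⟨u, hu⟩ ⟨y₁, hy₁⟩ ⟨y₂, hy₂⟩
              (mixCoeff β ⟨u, hu⟩ ⟨y₁, hy₁⟩ 𝒦 I₁) (mixCoeff β ⟨u, hu⟩ ⟨y₂, hy₂⟩ 𝒦 I₂) v₁ v₂ *
            (srcProb (Kc (box 4 L) β) ({⟨u, hu⟩} ∆ {v₁}) ({⟨u, hu⟩} ∆ {v₂}) Φ *
              srcProb (Kc (box 4 L) β) ({v₁} ∆ {⟨y₁, hy₁⟩}) ({v₂} ∆ {⟨y₂, hy₂⟩}) Ψ)| ≤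
        Real.sqrt (((1 - η)⁻¹ ^ 5 * (1 + ((2 * C * ((1 + (1 + c) / c) * 9 ^ 4 * C ^ 2 * (1 + κ) / γ)) +
            4 * ((1 + κ) * C + (2 * C + κ + 2 * C * κ))) / #𝒦)) ^ 2 - 1) +
        (2 * ((216 * (M₃ : ℝ) ^ 3) * (216 * ((N₄ + 1 : ℕ) : ℝ) ^ 3) * (CIR / ((N₄ + 1 - M₃ : ℕ) : ℝ) ^ 2) ^ 2 +
              (216 * (n₀ : ℝ) ^ 3) * (216 * ((m₀ + 1 : ℕ) : ℝ) ^ 3) * (CIR / ((m₀ + 1 - n₀ : ℕ) : ℝ) ^ 2) ^ 2) +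
            2 * ((216 * (R : ℝ) ^ 3) * ((CIR / (R : ℝ) ^ 2) * (CIR / ((R - M₃ : ℕ) : ℝ) ^ 2)) / ((1 - η) * sW) +
              (216 * (R : ℝ) ^ 3) * (216 * ((N₄ + 1 : ℕ) : ℝ) ^ 3) * (CIR / ((N₄ + 1 - R : ℕ) : ℝ) ^ 2) ^ 2 +
              θ * (216 * (r : ℝ) ^ 3) * (CIR / ((mℓ - r : ℕ) : ℝ) ^ 2) / (1 - η) +
              (216 * (n₀ : ℝ) ^ 3) * (216 * (r : ℝ) ^ 3) * (CIR / ((r - n₀ : ℕ) : ℝ) ^ 2) ^ 2)) := by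
  have hS : ∀ z, 0 < twoPointFree 4 β z := twoPointFree_pos_four hβ hβc
  filter_upwards [eventually_boxComparable hβ.le hη0 (mixPairs u y₁ 𝒦 I₁ ∪ mixPairs u y₂ 𝒦 I₂)] with L hL
  intro hu hy₁ hy₂ Φ Ψ hΦ1 hΨ1 hΦ hΨ
  obtain ⟨hu', hy₁', hIΛ₁, hlow₁, hblk₁⟩ := (hL.mono subset_union_left).mixPairs_spec
  obtain ⟨hu'', hy₂', hIΛ₂, hlow₂, hblk₂⟩ := (hL.mono subset_union_right).mixPairs_spec
  have hfar : ∀ {y : Site 4} (hy : y ∈ box 4 L), N₄ < Site.supNorm (y - u) →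
      (N₄ : ℝ) < dist (⟨u, hu⟩ : ↥(box 4 L)) ⟨y, hy⟩ := fun {y} hy h => by
    rw [dist_coe_eq_supNorm]; exact_mod_cast h
  exact box_mixingCore_prob hβ.le hS hIR hCIR ⟨u, hu⟩ ⟨y₁, hy₁⟩ ⟨y₂, hy₂⟩ 𝒦 I₁ I₂ hc hC hκ hγ hη0.le hη1 hsW hθ h𝒦 hreg
    hsep hY hI₁ hI₂ hcard₁ hcard₂ hdom₁ hdom₂ hIΛ₁ hIΛ₂ hn₀ hn₀r hrmℓ hrm h12 h23 hMR hRN hmℓ𝒦 hM𝒦 (hfar hy₁ hfar₁)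
    (hfar hy₂ hfar₂) hdomθ₁ hdomθ₂ hsW₁ hsW₂ hlow₁ hlow₂ hblk₁ hblk₂ hΦ1 hΨ1 hΦ hΨ

end Current

end Literature.Probability.LatticeModels
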